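import Mathlib.Analysis.Calculus.InverseFunctionTheorem.ContDiff
import Summits.SmoothPoincare4.SmoothPoincare4.Theorems.DottedCircleRasmussenDcrGapHelperFriendsCarrierVkDiscTube

/-!
# Helper `helper_friendsCarrier_Vk_partA_frameTube` (piece 6 of the registered stub
`helper_friendsCarrier_Vk_partA`, line `mk_friends`, skeleton v8) for crux `DcrGap`
(item stmt-SmoothPoincare4-16128, route route-SmoothPoincare4-DottedCircleRasmussen)

**The affine tube of an embedded disc on a PRESCRIBED transversal frame, with smooth inverse.**  The
landed `helper_friendsCarrier_Vk_discTube` builds the tube `F(x, w) = f x + w₀ n₀ x + w₁ n₁ x` of the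
slightly enlarged model slice disc on a normal frame of its own choosing (`exists_normalFrame`).  The
framing input of Part A (the topological statement "the tube framing is the disc framing") is phrased
for an ARBITRARY `C^∞` transversal pair `(m₀, m₁)` over the closed unit disc, and its geometric reduction
reads the push-offs of the knot tube in the coordinates of the affine tube on THAT pair; this file provides
the tube: transversality being an open condition (linear independence of
`(df e₀, df e₁, m₀, m₁)`, Mathlib's `isOpen_setOf_linearIndependent`), it holds on a larger open disc,
and the rest is the proof of `FriendsCarrierVk.exists_discTube` verbatim (local injectivity from the
inverse function theorem along the zero section, injectivity near the compact zero section, invertible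
derivative on a thinner tube, open image, `C^∞` inverse).

* `FriendsCarrierVk.exists_discTube_of_frame` / `helper_friendsCarrier_Vk_partA_frameTube` — the statement.

No definitions (the tube is the explicit lambda), no named facts, no `sorry`.

## References

* M. W. Hirsch, *Differential Topology*, GTM 33 (1976), Ch. 4 §5 Thm. 5.1 (tubular neighbourhoods),
  Ch. 2 §1 Ex. 7. [Hirsch1976]
-/

-- the prescribed namespace `Summit.<P>.<Sub>.…` duplicates `SmoothPoincare4` (P = Sub)
set_option linter.dupNamespace false
set_option linter.style.longLine false

noncomputable section

open scoped Manifold ContDiff Topology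
open Set Function Metric Filter
open Literature.Topology.FourManifolds Literature.Topology.FourManifolds.MMSW

namespace Summit.SmoothPoincare4.SmoothPoincare4.Theorems.DcrGap.MkFriends

namespace FriendsCarrierVk

/-- **The affine tube of an enlarged embedded disc on a prescribed transversal frame, with smooth
inverse.** [cite: Hirsch1976, Ch. 4 §5 Thm. 5.1] -/
theorem exists_discTube_of_frame {f : EuclideanSpace ℝ (Fin 2) → EuclideanSpace ℝ (Fin 4)}
    (hf : ContDiff ℝ ∞ f) (hinj : InjOn f (closedBall 0 1)) {m₀ m₁ : EuclideanSpace ℝ (Fin 2) → EuclideanSpace ℝ (Fin 4)}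
    (hm₀ : ContDiff ℝ ∞ m₀) (hm₁ : ContDiff ℝ ∞ m₁)
    (htr : ∀ x ∈ closedBall (0 : EuclideanSpace ℝ (Fin 2)) 1, ∀ (e : EuclideanSpace ℝ (Fin 2)) (α β : ℝ),
      fderiv ℝ f x e + α • m₀ x + β • m₁ x = 0 → e = 0 ∧ α = 0 ∧ β = 0) :
    ∃ (δ η : ℝ) (Finv : EuclideanSpace ℝ (Fin 4) → EuclideanSpace ℝ (Fin 2) × EuclideanSpace ℝ (Fin 2)),
      0 < δ ∧ 0 < η ∧ InjOn f (closedBall 0 (1 + δ)) ∧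
      (∀ x ∈ ball (0 : EuclideanSpace ℝ (Fin 2)) (1 + 2 * δ), Injective (fderiv ℝ f x)) ∧
      (∀ x ∈ ball (0 : EuclideanSpace ℝ (Fin 2)) (1 + 2 * δ), ∀ (e : EuclideanSpace ℝ (Fin 2)) (α β : ℝ),
        fderiv ℝ f x e + α • m₀ x + β • m₁ x = 0 → e = 0 ∧ α = 0 ∧ β = 0) ∧
      ContDiff ℝ ∞ (fun q : EuclideanSpace ℝ (Fin 2) × EuclideanSpace ℝ (Fin 2) => f q.1 + q.2 0 • m₀ q.1 + q.2 1 • m₁ q.1) ∧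
      InjOn (fun q : EuclideanSpace ℝ (Fin 2) × EuclideanSpace ℝ (Fin 2) => f q.1 + q.2 0 • m₀ q.1 + q.2 1 • m₁ q.1)
        (closedBall (0 : EuclideanSpace ℝ (Fin 2)) (1 + δ) ×ˢ closedBall (0 : EuclideanSpace ℝ (Fin 2)) η) ∧
      IsOpen ((fun q : EuclideanSpace ℝ (Fin 2) × EuclideanSpace ℝ (Fin 2) => f q.1 + q.2 0 • m₀ q.1 + q.2 1 • m₁ q.1) ''
        (ball (0 : EuclideanSpace ℝ (Fin 2)) (1 + δ) ×ˢ ball (0 : EuclideanSpace ℝ (Fin 2)) η)) ∧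
      ContDiffOn ℝ ∞ Finv ((fun q : EuclideanSpace ℝ (Fin 2) × EuclideanSpace ℝ (Fin 2) => f q.1 + q.2 0 • m₀ q.1 + q.2 1 • m₁ q.1) ''
        (ball (0 : EuclideanSpace ℝ (Fin 2)) (1 + δ) ×ˢ ball (0 : EuclideanSpace ℝ (Fin 2)) η)) ∧
      (∀ q ∈ ball (0 : EuclideanSpace ℝ (Fin 2)) (1 + δ) ×ˢ ball (0 : EuclideanSpace ℝ (Fin 2)) η,
        Finv (f q.1 + q.2 0 • m₀ q.1 + q.2 1 • m₁ q.1) = q) := by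
  -- the frame as a family
  set n : Fin 2 → EuclideanSpace ℝ (Fin 2) → EuclideanSpace ℝ (Fin 4) := ![m₀, m₁] with hndef
  have hn0 : n 0 = m₀ := rfl
  have hn1 : n 1 = m₁ := rfl
  have hnsg : ∀ i, ContDiff ℝ ∞ (n i) := fun i => by fin_cases i <;> assumption
  -- immersivity on the closed unit disc from transversality
  have himm : ∀ x ∈ closedBall (0 : EuclideanSpace ℝ (Fin 2)) 1, Injective (fderiv ℝ f x) := fun x hx =>
    (injective_iff_map_eq_zero _).2 fun v hv => (htr x hx v 0 0 (by rw [hv]; simp)).1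
  -- transversality is open: it holds on a larger closed disc
  have hopen : IsOpen {x : EuclideanSpace ℝ (Fin 2) | ∀ (e : EuclideanSpace ℝ (Fin 2)) (α β : ℝ),
      fderiv ℝ f x e + α • m₀ x + β • m₁ x = 0 → e = 0 ∧ α = 0 ∧ β = 0} := by
    have hc : Continuous fun x : EuclideanSpace ℝ (Fin 2) =>
        (![fderiv ℝ f x (EuclideanSpace.single 0 1), fderiv ℝ f x (EuclideanSpace.single 1 1), m₀ x, m₁ x] :
          Fin 4 → EuclideanSpace ℝ (Fin 4)) := by
      have hd : Continuous (fderiv ℝ f) := hf.continuous_fderiv (by simp)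
      refine continuous_pi fun i => ?_
      fin_cases i
      · exact hd.clm_apply continuous_const
      · exact hd.clm_apply continuous_const
      · exact hm₀.continuous
      · exact hm₁.continuous
    have key : ∀ x : EuclideanSpace ℝ (Fin 2), (∀ (e : EuclideanSpace ℝ (Fin 2)) (α β : ℝ),
        fderiv ℝ f x e + α • m₀ x + β • m₁ x = 0 → e = 0 ∧ α = 0 ∧ β = 0) ↔ LinearIndependent ℝ
        (![fderiv ℝ f x (EuclideanSpace.single 0 1), fderiv ℝ f x (EuclideanSpace.single 1 1), m₀ x, m₁ x] :
          Fin 4 → EuclideanSpace ℝ (Fin 4)) := by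
      intro x
      have e4 := transversal_iff_linearIndependent_four (L := fderiv ℝ f x) (n := fun i => n i x)
      simp only [hn0, hn1] at e4
      rw [← e4]
      constructor
      · intro h v a hva
        have := h v (a 0) (a 1) (by rw [Fin.sum_univ_two] at hva; simpa [hn0, hn1, add_assoc] using hva)
        refine ⟨this.1, ?_⟩
        ext i; fin_cases i
        · simpa using this.2.1
        · simpa using this.2.2
      · intro h e α β heq
        have := h e (!₂[α, β]) (by rw [Fin.sum_univ_two]; simpa [hn0, hn1, add_assoc] using heq)
        exact ⟨this.1, by simpa using congrArg (fun z : EuclideanSpace ℝ (Fin 2) => z 0) this.2,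
          by simpa using congrArg (fun z : EuclideanSpace ℝ (Fin 2) => z 1) this.2⟩
    have : {x : EuclideanSpace ℝ (Fin 2) | ∀ (e : EuclideanSpace ℝ (Fin 2)) (α β : ℝ),
        fderiv ℝ f x e + α • m₀ x + β • m₁ x = 0 → e = 0 ∧ α = 0 ∧ β = 0} = (fun x : EuclideanSpace ℝ (Fin 2) =>
        (![fderiv ℝ f x (EuclideanSpace.single 0 1), fderiv ℝ f x (EuclideanSpace.single 1 1), m₀ x, m₁ x] :
          Fin 4 → EuclideanSpace ℝ (Fin 4))) ⁻¹' {v | LinearIndependent ℝ v} := by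
      ext x; exact key x
    rw [this]
    exact isOpen_setOf_linearIndependent.preimage hc
  obtain ⟨ε₀, hε₀, hthick₀⟩ := (isCompact_closedBall (0 : EuclideanSpace ℝ (Fin 2)) 1).exists_thickening_subset_open hopen htr
  -- injectivity and immersivity on a larger closed disc
  obtain ⟨δ₁, hδ₁, hinj₁, himm₁⟩ := exists_injOn_closedBall_of_immersion hf hinj himm
  set δ₀ : ℝ := min δ₁ (ε₀ / 2) with hδ₀def
  have hδ₀ : 0 < δ₀ := lt_min hδ₁ (by linarith)
  have hinj₀ : InjOn f (closedBall 0 (1 + δ₀)) := hinj₁.mono (closedBall_subset_closedBall (by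
    have := min_le_left δ₁ (ε₀ / 2); linarith))
  set R' : ℝ := 1 + ε₀ with hR'def
  have hR' : 1 + δ₀ < R' := by have := min_le_right δ₁ (ε₀ / 2); rw [hR'def]; linarith
  have htr' : ∀ x ∈ ball (0 : EuclideanSpace ℝ (Fin 2)) R', ∀ (e : EuclideanSpace ℝ (Fin 2)) (α β : ℝ),
      fderiv ℝ f x e + α • m₀ x + β • m₁ x = 0 → e = 0 ∧ α = 0 ∧ β = 0 := fun x hx => hthick₀ (by
    rw [thickening_closedBall hε₀ zero_le_one, add_comm]; exact hx)
  have himm' : ∀ x ∈ ball (0 : EuclideanSpace ℝ (Fin 2)) R', Injective (fderiv ℝ f x) := fun x hx =>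
    (injective_iff_map_eq_zero _).2 fun v hv => (htr' x hx v 0 0 (by rw [hv]; simp)).1
  have hns : ∀ i, ContDiffOn ℝ ∞ (n i) (ball (0 : EuclideanSpace ℝ (Fin 2)) R') := fun i => (hnsg i).contDiffOn
  -- radii: `1 + 2δ < R'`, `δ ≤ δ₀`
  set δ : ℝ := min δ₀ ((R' - (1 + δ₀)) / 2) / 2 with hδdef
  have hδpos : 0 < δ := by
    rw [hδdef]; have := lt_min hδ₀ (by linarith : (0 : ℝ) < (R' - (1 + δ₀)) / 2); linarith
  have hδδ₀ : δ ≤ δ₀ := by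
    rw [hδdef]; have := min_le_left δ₀ ((R' - (1 + δ₀)) / 2); linarith [hδ₀]
  have h2δ : 1 + 2 * δ < R' := by
    rw [hδdef]; have := min_le_right δ₀ ((R' - (1 + δ₀)) / 2); linarith
  -- the tube
  set F : EuclideanSpace ℝ (Fin 2) × EuclideanSpace ℝ (Fin 2) → EuclideanSpace ℝ (Fin 4) :=
    fun q => f q.1 + q.2 0 • n 0 q.1 + q.2 1 • n 1 q.1 with hFdef
  have hF0 : ∀ x, F (x, 0) = f x := fun x => by simp [hFdef]
  -- smoothness on `B(0, R') × ℝ²`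
  have hcoord : ∀ i : Fin 2, ContDiff ℝ ∞ fun q : EuclideanSpace ℝ (Fin 2) × EuclideanSpace ℝ (Fin 2) => q.2 i :=
    fun i => by fun_prop
  have hFat : ∀ q : EuclideanSpace ℝ (Fin 2) × EuclideanSpace ℝ (Fin 2), q.1 ∈ ball (0 : EuclideanSpace ℝ (Fin 2)) R' →
      ContDiffAt ℝ ∞ F q := by
    intro q hq
    have hn' : ∀ i, ContDiffAt ℝ ∞ (fun q : EuclideanSpace ℝ (Fin 2) × EuclideanSpace ℝ (Fin 2) => n i q.1) q :=
      fun i => ((hns i).contDiffAt (isOpen_ball.mem_nhds hq)).comp q contDiffAt_fst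
    simp only [hFdef]
    exact ((hf.contDiffAt.comp q contDiffAt_fst).add ((hcoord 0).contDiffAt.smul (hn' 0))).add
      ((hcoord 1).contDiffAt.smul (hn' 1))
  have hFon : ContDiffOn ℝ ∞ F (ball (0 : EuclideanSpace ℝ (Fin 2)) (1 + 2 * δ) ×ˢ univ) := fun q hq =>
    (hFat q (ball_subset_ball h2δ.le hq.1)).contDiffWithinAt
  -- the derivative along the zero section: `(v, a) ↦ df v + a₀ n₀ + a₁ n₁`, injective by transversality
  set L₀ : EuclideanSpace ℝ (Fin 2) → (EuclideanSpace ℝ (Fin 2) × EuclideanSpace ℝ (Fin 2) →L[ℝ] EuclideanSpace ℝ (Fin 4)) :=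
    fun x => (fderiv ℝ f x).comp (ContinuousLinearMap.fst ℝ (EuclideanSpace ℝ (Fin 2)) (EuclideanSpace ℝ (Fin 2))) +
      ((EuclideanSpace.proj (𝕜 := ℝ) (0 : Fin 2)).comp
        (ContinuousLinearMap.snd ℝ (EuclideanSpace ℝ (Fin 2)) (EuclideanSpace ℝ (Fin 2)))).smulRight (n 0 x) +
      ((EuclideanSpace.proj (𝕜 := ℝ) (1 : Fin 2)).comp
        (ContinuousLinearMap.snd ℝ (EuclideanSpace ℝ (Fin 2)) (EuclideanSpace ℝ (Fin 2)))).smulRight (n 1 x) with hL₀def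
  have hL₀apply : ∀ (x v a : EuclideanSpace ℝ (Fin 2)), L₀ x (v, a) = fderiv ℝ f x v + a 0 • n 0 x + a 1 • n 1 x := by
    intro x v a
    simp [hL₀def]
  have hderiv0 : ∀ x ∈ ball (0 : EuclideanSpace ℝ (Fin 2)) R', HasFDerivAt F (L₀ x) (x, 0) := by
    intro x hx
    have hf' : HasFDerivAt (fun q : EuclideanSpace ℝ (Fin 2) × EuclideanSpace ℝ (Fin 2) => f q.1)
        ((fderiv ℝ f x).comp (ContinuousLinearMap.fst ℝ (EuclideanSpace ℝ (Fin 2)) (EuclideanSpace ℝ (Fin 2)))) (x, 0) :=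
      ((hf.differentiable (by simp)) x).hasFDerivAt.comp (x, 0) hasFDerivAt_fst
    have hni : ∀ i : Fin 2, HasFDerivAt (fun q : EuclideanSpace ℝ (Fin 2) × EuclideanSpace ℝ (Fin 2) => q.2 i • n i q.1)
        (((EuclideanSpace.proj (𝕜 := ℝ) i).comp
          (ContinuousLinearMap.snd ℝ (EuclideanSpace ℝ (Fin 2)) (EuclideanSpace ℝ (Fin 2)))).smulRight (n i x)) (x, 0) := by
      intro i
      have hc : HasFDerivAt (fun q : EuclideanSpace ℝ (Fin 2) × EuclideanSpace ℝ (Fin 2) => q.2 i)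
          ((EuclideanSpace.proj (𝕜 := ℝ) i).comp
            (ContinuousLinearMap.snd ℝ (EuclideanSpace ℝ (Fin 2)) (EuclideanSpace ℝ (Fin 2)))) (x, 0) :=
        ((EuclideanSpace.proj (𝕜 := ℝ) i).hasFDerivAt).comp (x, 0) hasFDerivAt_snd
      have hnd : HasFDerivAt (fun q : EuclideanSpace ℝ (Fin 2) × EuclideanSpace ℝ (Fin 2) => n i q.1)
          ((fderiv ℝ (n i) x).comp (ContinuousLinearMap.fst ℝ (EuclideanSpace ℝ (Fin 2)) (EuclideanSpace ℝ (Fin 2)))) (x, 0) :=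
        ((((hns i).contDiffAt (isOpen_ball.mem_nhds hx)).differentiableAt (by simp)).hasFDerivAt).comp (x, 0)
          hasFDerivAt_fst
      refine (hc.fun_smul hnd).congr_fderiv ?_
      simp
    have h := (hf'.fun_add (hni 0)).fun_add (hni 1)
    rw [hFdef]
    exact h
  have hinjL : ∀ x ∈ ball (0 : EuclideanSpace ℝ (Fin 2)) R', Injective (L₀ x) := by
    intro x hx
    refine (injective_iff_map_eq_zero _).2 ?_
    rintro ⟨v, a⟩ h
    rw [hL₀apply] at h
    obtain ⟨hv, ha0, ha1⟩ := htr' x hx v (a 0) (a 1) h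
    have ha : a = 0 := by ext i; fin_cases i <;> simp [ha0, ha1]
    simp [hv, ha]
  -- the derivative as an equivalence along the zero section, strictness, local injectivity, openness
  have hfin : Module.finrank ℝ (EuclideanSpace ℝ (Fin 2) × EuclideanSpace ℝ (Fin 2)) = Module.finrank ℝ (EuclideanSpace ℝ (Fin 4)) := by
    simp
  have hstrict0 : ∀ x ∈ ball (0 : EuclideanSpace ℝ (Fin 2)) R', ∃ L : (EuclideanSpace ℝ (Fin 2) × EuclideanSpace ℝ (Fin 2)) ≃L[ℝ] EuclideanSpace ℝ (Fin 4),
      HasStrictFDerivAt F (L : _ →L[ℝ] _) (x, 0) := by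
    intro x hx
    have hbij : Bijective (L₀ x) := ⟨hinjL x hx,
      (LinearMap.injective_iff_surjective_of_finrank_eq_finrank hfin).1 (hinjL x hx)⟩
    set L : (EuclideanSpace ℝ (Fin 2) × EuclideanSpace ℝ (Fin 2)) ≃L[ℝ] EuclideanSpace ℝ (Fin 4) :=
      (LinearEquiv.ofBijective ((L₀ x : EuclideanSpace ℝ (Fin 2) × EuclideanSpace ℝ (Fin 2) →L[ℝ] EuclideanSpace ℝ (Fin 4)) :
        EuclideanSpace ℝ (Fin 2) × EuclideanSpace ℝ (Fin 2) →ₗ[ℝ] EuclideanSpace ℝ (Fin 4)) hbij).toContinuousLinearEquiv with hL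
    have hLc : (L : EuclideanSpace ℝ (Fin 2) × EuclideanSpace ℝ (Fin 2) →L[ℝ] EuclideanSpace ℝ (Fin 4)) = L₀ x :=
      ContinuousLinearMap.ext fun _ => rfl
    refine ⟨L, ?_⟩
    rw [hLc]
    exact (hFat (x, 0) hx).hasStrictFDerivAt' (hderiv0 x hx) (by simp)
  -- injectivity on `B̄(0, 1 + δ₀) × B(0, ε)` from local injectivity and injectivity of the zero section
  haveI : CompactSpace (closedBall (0 : EuclideanSpace ℝ (Fin 2)) (1 + δ₀)) :=
    isCompact_iff_compactSpace.1 (isCompact_closedBall _ _)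
  have hsub₀ : closedBall (0 : EuclideanSpace ℝ (Fin 2)) (1 + δ₀) ⊆ ball 0 R' := closedBall_subset_ball hR'
  obtain ⟨ε, hε, hinjε⟩ := exists_injOn_prod_ball
    (g := fun p : closedBall (0 : EuclideanSpace ℝ (Fin 2)) (1 + δ₀) × EuclideanSpace ℝ (Fin 2) => F ((p.1 : EuclideanSpace ℝ (Fin 2)), p.2))
    (by
      have hFc : ContinuousOn F (ball (0 : EuclideanSpace ℝ (Fin 2)) R' ×ˢ univ) := fun q hq =>
        (hFat q hq.1).continuousAt.continuousWithinAt
      exact hFc.comp_continuous (by fun_prop) fun p => ⟨hsub₀ p.1.2, mem_univ _⟩)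
    (by
      intro a b hab
      simp only [hF0] at hab
      exact Subtype.ext (hinj₀ a.2 b.2 hab))
    (by
      intro a
      obtain ⟨L, hL⟩ := hstrict0 a (hsub₀ a.2)
      set Φ := hL.toOpenPartialHomeomorph F with hΦ
      have hsrc : Φ.source ∈ 𝓝 (((a : EuclideanSpace ℝ (Fin 2)), (0 : EuclideanSpace ℝ (Fin 2))) : EuclideanSpace ℝ (Fin 2) × EuclideanSpace ℝ (Fin 2)) :=
        Φ.open_source.mem_nhds hL.mem_toOpenPartialHomeomorph_source
      have hcont : Continuous fun p : closedBall (0 : EuclideanSpace ℝ (Fin 2)) (1 + δ₀) × EuclideanSpace ℝ (Fin 2) =>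
          (((p.1 : EuclideanSpace ℝ (Fin 2)), p.2) : EuclideanSpace ℝ (Fin 2) × EuclideanSpace ℝ (Fin 2)) := by fun_prop
      refine ⟨_, hcont.continuousAt.preimage_mem_nhds hsrc, fun p hp q hq hpq => ?_⟩
      have h : (((p.1 : EuclideanSpace ℝ (Fin 2)), p.2) : EuclideanSpace ℝ (Fin 2) × EuclideanSpace ℝ (Fin 2)) =
          ((q.1 : EuclideanSpace ℝ (Fin 2)), q.2) :=
        Φ.injOn hp hq (by simpa [hΦ, HasStrictFDerivAt.toOpenPartialHomeomorph_coe] using hpq)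
      obtain ⟨h1, h2⟩ := Prod.mk.inj h
      exact Prod.ext (Subtype.ext h1) h2)
  have hinjF : InjOn F (closedBall (0 : EuclideanSpace ℝ (Fin 2)) (1 + δ₀) ×ˢ ball (0 : EuclideanSpace ℝ (Fin 2)) ε) := by
    rintro ⟨x, v⟩ ⟨hx, hv⟩ ⟨y, w⟩ ⟨hy, hw⟩ h
    have := hinjε (mk_mem_prod (mem_univ (⟨x, hx⟩ : closedBall (0 : EuclideanSpace ℝ (Fin 2)) (1 + δ₀))) hv)
      (mk_mem_prod (mem_univ (⟨y, hy⟩ : closedBall (0 : EuclideanSpace ℝ (Fin 2)) (1 + δ₀))) hw) h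
    simp only [Prod.mk.injEq, Subtype.mk.injEq] at this
    exact Prod.ext this.1 this.2
  -- invertible derivative on `B̄(0, 1 + δ₀) × B̄(0, η₁)` (openness of invertibility, compactness)
  set Ω : Set (EuclideanSpace ℝ (Fin 2) × EuclideanSpace ℝ (Fin 2)) :=
    (ball (0 : EuclideanSpace ℝ (Fin 2)) R' ×ˢ univ) ∩ (fun q => fderiv ℝ F q) ⁻¹'
      range ((↑) : ((EuclideanSpace ℝ (Fin 2) × EuclideanSpace ℝ (Fin 2)) ≃L[ℝ] EuclideanSpace ℝ (Fin 4)) →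
        (EuclideanSpace ℝ (Fin 2) × EuclideanSpace ℝ (Fin 2)) →L[ℝ] EuclideanSpace ℝ (Fin 4)) with hΩ
  have hΩo : IsOpen Ω := by
    have hc : ContinuousOn (fun q => fderiv ℝ F q) (ball (0 : EuclideanSpace ℝ (Fin 2)) R' ×ˢ univ) := by
      have h1 : ContDiffOn ℝ ∞ F (ball (0 : EuclideanSpace ℝ (Fin 2)) R' ×ˢ univ) := fun q hq => (hFat q hq.1).contDiffWithinAt
      exact h1.continuousOn_fderiv_of_isOpen (isOpen_ball.prod isOpen_univ) (by simp)
    exact hc.isOpen_inter_preimage (isOpen_ball.prod isOpen_univ) ContinuousLinearEquiv.isOpen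
  have hK₀ : closedBall (0 : EuclideanSpace ℝ (Fin 2)) (1 + δ₀) ×ˢ ({0} : Set (EuclideanSpace ℝ (Fin 2))) ⊆ Ω := by
    rintro ⟨x, w⟩ ⟨hx, hw⟩
    rw [mem_singleton_iff] at hw
    subst hw
    obtain ⟨L, hL⟩ := hstrict0 x (hsub₀ hx)
    exact ⟨⟨hsub₀ hx, mem_univ _⟩, ⟨L, hL.hasFDerivAt.fderiv.symm⟩⟩
  obtain ⟨η₁, hη₁, hthick⟩ := ((isCompact_closedBall (0 : EuclideanSpace ℝ (Fin 2)) (1 + δ₀)).prod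
    isCompact_singleton).exists_thickening_subset_open hΩo hK₀
  have hΩmem : ∀ q : EuclideanSpace ℝ (Fin 2) × EuclideanSpace ℝ (Fin 2), q.1 ∈ closedBall (0 : EuclideanSpace ℝ (Fin 2)) (1 + δ₀) →
      ‖q.2‖ < η₁ → q ∈ Ω := by
    rintro ⟨x, w⟩ hx hw
    refine hthick (Metric.mem_thickening_iff.2 ⟨(x, 0), ⟨hx, rfl⟩, ?_⟩)
    rw [Prod.dist_eq, dist_self, dist_zero_right]
    exact max_lt_iff.2 ⟨hη₁, hw⟩
  have hstrict : ∀ q : EuclideanSpace ℝ (Fin 2) × EuclideanSpace ℝ (Fin 2), q ∈ Ω →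
      ∃ L : (EuclideanSpace ℝ (Fin 2) × EuclideanSpace ℝ (Fin 2)) ≃L[ℝ] EuclideanSpace ℝ (Fin 4),
        HasStrictFDerivAt F (L : _ →L[ℝ] _) q := by
    rintro q ⟨hq, ⟨L, hL⟩⟩
    refine ⟨L, ?_⟩
    rw [hL]
    exact (hFat q hq.1).hasStrictFDerivAt (by simp)
  -- the final radii
  set η : ℝ := min ε η₁ / 2 with hηdef
  have hηpos : 0 < η := by rw [hηdef]; have := lt_min hε hη₁; linarith
  have hηε : η < ε := by rw [hηdef]; have := min_le_left ε η₁; linarith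
  have hηη₁ : η < η₁ := by rw [hηdef]; have := min_le_right ε η₁; linarith
  set dom : Set (EuclideanSpace ℝ (Fin 2) × EuclideanSpace ℝ (Fin 2)) :=
    ball (0 : EuclideanSpace ℝ (Fin 2)) (1 + δ) ×ˢ ball (0 : EuclideanSpace ℝ (Fin 2)) η with hdom
  have hdomo : IsOpen dom := isOpen_ball.prod isOpen_ball
  have hdomΩ : dom ⊆ Ω := fun q hq =>
    hΩmem q (mem_closedBall_zero_iff.2 (by linarith [mem_ball_zero_iff.1 hq.1])) (lt_trans (mem_ball_zero_iff.1 hq.2) hηη₁)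
  have hdominj : dom ⊆ closedBall (0 : EuclideanSpace ℝ (Fin 2)) (1 + δ₀) ×ˢ ball (0 : EuclideanSpace ℝ (Fin 2)) ε := fun q hq =>
    ⟨mem_closedBall_zero_iff.2 (by linarith [mem_ball_zero_iff.1 hq.1]), mem_ball_zero_iff.2 (lt_trans (mem_ball_zero_iff.1 hq.2) hηε)⟩
  -- openness of the image
  have hopen : IsOpen (F '' dom) := by
    rw [isOpen_iff_mem_nhds]
    rintro _ ⟨q, hq, rfl⟩
    obtain ⟨L, hL⟩ := hstrict q (hdomΩ hq)
    rw [← hL.map_nhds_eq_of_equiv]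
    exact Filter.image_mem_map (hdomo.mem_nhds hq)
  -- the inverse and its smoothness
  set Finv : EuclideanSpace ℝ (Fin 4) → EuclideanSpace ℝ (Fin 2) × EuclideanSpace ℝ (Fin 2) := invFunOn F dom with hFinv
  have hinjdom : InjOn F dom := hinjF.mono hdominj
  have hleft : ∀ q ∈ dom, Finv (F q) = q := fun q hq => hinjdom.leftInvOn_invFunOn hq
  have hsmooth : ContDiffOn ℝ ∞ Finv (F '' dom) := by
    rintro _ ⟨q, hq, rfl⟩
    refine ContDiffAt.contDiffWithinAt ?_
    obtain ⟨L, hL⟩ := hstrict q (hdomΩ hq)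
    have hev : ∀ᶠ p in 𝓝 q, Finv (F p) = p := by
      filter_upwards [hdomo.mem_nhds hq] with p hp
      exact hleft p hp
    have huniq := hL.localInverse_unique hev
    have hcd : ContDiffAt ℝ ∞ F q := hFat q (hdomΩ hq).1.1
    have hloc : ContDiffAt ℝ ∞ (hcd.localInverse hL.hasFDerivAt (by simp)) (F q) :=
      hcd.to_localInverse hL.hasFDerivAt (by simp)
    exact hloc.congr_of_eventuallyEq huniq
  have hFglob : ContDiff ℝ ∞ F := by
    simp only [hFdef]
    exact ((hf.comp contDiff_fst).add ((hcoord 0).smul (hm₀.comp contDiff_fst))).add ((hcoord 1).smul (hm₁.comp contDiff_fst))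
  refine ⟨δ, η, Finv, hδpos, hηpos, hinj₀.mono (closedBall_subset_closedBall (by linarith)),
    fun x hx => himm' x (ball_subset_ball h2δ.le hx), fun x hx => htr' x (ball_subset_ball h2δ.le hx), hFglob, ?_, hopen, hsmooth,
    fun q hq => hleft q hq⟩
  exact hinjF.mono (prod_mono (closedBall_subset_closedBall (by linarith)) (closedBall_subset_ball hηε))

end FriendsCarrierVk

open FriendsCarrierVk in
/-- **Helper `helper_friendsCarrier_Vk_partA_frameTube`** (piece of `helper_friendsCarrier_Vk_partA`: the affine
tube on a prescribed frame).  For `f : ℝ² → ℝ⁴` of class `C^∞`, injective on the closed unit disc, and a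
`C^∞` pair `(m₀, m₁)` transversal to `f` over the closed unit disc, there are `δ, η > 0` and a `C^∞` left
inverse `Finv`, on the open image of `B(0, 1 + δ) × B(0, η)`, of the tube `F(x, w) = f x + w₀ m₀ x + w₁ m₁ x`,
which is injective on `B̄(0, 1 + δ) × B̄(0, η)`; moreover `f` is injective on `B̄(0, 1 + δ)` and immersive and
transversal to `(m₀, m₁)` on `B(0, 1 + 2δ)`. [cite: Hirsch1976, Ch. 4 §5 Thm. 5.1] -/
theorem helper_friendsCarrier_Vk_partA_frameTube : ∀ (f : EuclideanSpace ℝ (Fin 2) → EuclideanSpace ℝ (Fin 4)) (m₀ m₁ : EuclideanSpace ℝ (Fin 2) → EuclideanSpace ℝ (Fin 4)), ContDiff ℝ ((⊤ : ℕ∞) : WithTop ℕ∞) f → Set.InjOn f (Metric.closedBall 0 1) → ContDiff ℝ ((⊤ : ℕ∞) : WithTop ℕ∞) m₀ → ContDiff ℝ ((⊤ : ℕ∞) : WithTop ℕ∞) m₁ → (∀ x ∈ Metric.closedBall (0 : EuclideanSpace ℝ (Fin 2)) 1, ∀ (e : EuclideanSpace ℝ (Fin 2)) (α β : ℝ), fderiv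 ℝ f x e + α • m₀ x + β • m₁ x = 0 → e = 0 ∧ α = 0 ∧ β = 0) → ∃ (δ η : ℝ) (Finv : EuclideanSpace ℝ (Fin 4) → EuclideanSpace ℝ (Fin 2) × EuclideanSpace ℝ (Fin 2)), 0 < δ ∧ 0 < η ∧ Set.InjOn f (Metric.closedBall 0 (1 + δ)) ∧ (∀ x ∈ Metric.ball (0 : EuclideanSpace ℝ (Fin 2)) (1 + 2 * δ), Function.Injective (fderiv ℝ f x)) ∧ (∀ x ∈ Metric.ball (0 : EuclideanSpace ℝ (Fin 2)) (1 + 2 * δ), ∀ (e : EuclideanSpace ℝ (Fin 2)) (α β : ℝ), fderiv ℝ f x e + α • m₀ x + β • m₁ x = 0 → e = 0 ∧ α = 0 ∧ β = 0) ∧ ContDiff ℝ ((⊤ : ℕ∞) : WithTop ℕ∞) (fun q : EuclideanSpace ℝ (Fin 2) × EuclideanSpace ℝ (Fin 2) => f q.1 + q.2 0 • m₀ q.1 + q.2 1 • m₁ q.1) ∧ Set.InjOn (fun q : EuclideanSpace ℝ (Fin 2) × EuclideanSpace ℝ (Fin 2) => f q.1 + q.2 0 • m₀ q.1 + q.2 1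 • m₁ q.1) (Metric.closedBall (0 : EuclideanSpace ℝ (Fin 2)) (1 + δ) ×ˢ Metric.closedBall (0 : EuclideanSpace ℝ (Fin 2)) η) ∧ IsOpen ((fun q : EuclideanSpace ℝ (Fin 2) × EuclideanSpace ℝ (Fin 2) => f q.1 + q.2 0 • m₀ q.1 + q.2 1 • m₁ q.1) '' (Metric.ball (0 : EuclideanSpace ℝ (Fin 2)) (1 + δ) ×ˢ Metric.ball (0 : EuclideanSpace ℝ (Fin 2)) η)) ∧ ContDiffOn ℝ ((⊤ : ℕ∞) : WithTop ℕ∞) Finv ((fun q : EuclideanSpace ℝ (Fin 2) × EuclideanSpace ℝ (Fin 2) => f q.1 + q.2 0 • m₀ q.1 + q.2 1 • m₁ q.1) '' (Metric.ball (0 : EuclideanSpace ℝ (Fin 2)) (1 + δ) ×ˢ Metric.ball (0 : EuclideanSpace ℝ (Fin 2)) η)) ∧ (∀ q ∈ Metric.ball (0 : EuclideanSpace ℝ (Fin 2)) (1 + δ) ×ˢ Metric.ball (0 : EuclideanSpace ℝ (Fin 2)) η, Finv (f q.1 + q.2 0 • m₀ q.1 + q.2 1 • m₁ q.1) = q) :=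 by
  intro f m₀ m₁ hf hinj hm₀ hm₁ htr
  exact exists_discTube_of_frame hf hinj hm₀ hm₁ htr

end Summit.SmoothPoincare4.SmoothPoincare4.Theorems.DcrGap.MkFriends

end
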